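import Literature.Analysis.FluidPDE.AncientMildWeak
import Literature.Analysis.FluidPDE.BoundedAnnihilator
import Literature.Analysis.FluidPDE.AxisymmetricVorticityTransport
import HarnessLib

/-!
# The bridge from KNSS's Theorem 5.3 (bounded weak solutions) to the duality-form fact

Analysis/FluidPDE support file (all results proved) for the named fact
`Literature.Analysis.FluidPDE.knss_bound_C_over_r` (`SelfSimilarLiouville`; Koch–Nadirashvili–
Seregin–Šverák 2009, Theorem 5.3), continuing `KNSSLiouville` (the theorem as printed, for
bounded weak solutions: `Literature.Analysis.FluidPDE.KNSS2009_liouville_bound_C_over_r`),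
`AncientMildPairing` (pairings with divergence-free tests are continuous in time),
`BoundedAnnihilator` (the `L^∞` annihilator lemma) and `AncientMildWeak` (mild ⇒ weak in `L^∞`).
It assembles these into the bridge from the printed theorem to the duality-form fact:

* `IsBoundedAncientMildSolution.exists_ae_eq_const_of_ae_restrict` (any dimension): if a
  bounded ancient mild solution with measurable slices vanishes a.e. on a.e. slice `t < 0`, then
  *every* slice is a.e. constant (continuity of the pairings + annihilator lemma); with the decay
  `r ‖u(t)‖ ≤ C` a.e. on every slice the constants vanish (`…ae_eq_zero_of_ae_restrict`, `ℝ³`).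
* `KNSS2009_liouville_bound_C_over_r.ae_eq_zero_of_aestronglyMeasurable` (**core bridge**):
  Theorem 5.3 in the printed class implies that a bounded ancient mild solution (`ν = 1`) which
  is jointly a.e. strongly measurable on `(-∞, 0) × ℝ³`, with measurable slices, a.e.
  axisymmetric and a.e. decaying like `C/r`, vanishes a.e. on every slice `t < 0`; in the
  pointwise hypotheses of the fact: `knss_bound_C_over_r_of_KNSS2009_of_aestronglyMeasurable`.
* `knss_bound_C_over_r_of_KNSS2009_of_modification`: Theorem 5.3 in the printed class implies
  `knss_bound_C_over_r` **provided** every family `u` in its hypotheses admits a jointly a.e.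
  strongly measurable modification `w` with `w t = u t` a.e. for every `t < 0` (the class, the
  symmetry and the decay transfer to a truncation of `w`: `IsBoundedAncientMildSolution.congr_ae_slice`,
  `exists_bounded_modification`, rotations preserve Lebesgue measure).

## What remains for `knss_bound_C_over_r_holds`

(i) The printed theorem `KNSS2009_liouville_bound_C_over_r` itself (KNSS 2009, §4 regularity,
Lemma 2.1, Theorem 5.2 and the cut-off argument of p. 10; none of it is in Mathlib or the tree).
(ii) The modification hypothesis of `knss_bound_C_over_r_of_KNSS2009_of_modification`: the
duality-form class quantifies over families `u : ℝ → ℝ³ → ℝ³` with measurable *slices* only,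
and a family with measurable slices need not be jointly measurable (nor agree slice-wise a.e.
with a jointly measurable one). For families in the class with the decay bound, a jointly
measurable modification should exist — the pairings with divergence-free tests are continuous
in time (`AncientMildPairing`), the decay pins the spatial constants, so `t ↦ u(t)` ought to be
weak-* continuous and its spatial mollifications jointly continuous — but this is not proved here.

## References

* G. Koch, N. Nadirashvili, G. Seregin, V. Šverák, *Liouville theorems for the Navier–Stokes
  equations and applications*, Acta Math. 203 (2009) 83–105 = arXiv:0709.3599, Theorem 5.3 and
  its proof, p. 10; §1 p. 3 (the spatially constant ambiguity `b(t)`); §4 (i)–(ii) p. 8.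
  [KochNadirashviliSereginSverak2009]
-/

noncomputable section

open MeasureTheory Set Function Filter Topology TopologicalSpace InnerProductSpace
open scoped RealInnerProductSpace NNReal ENNReal

namespace Literature.Analysis.FluidPDE

/-! ### From a.e.-in-time conclusions to every slice -/

section EverySlice

variable {E : Type*} [NormedAddCommGroup E] [InnerProductSpace ℝ E] [FiniteDimensional ℝ E]
  [MeasurableSpace E] [BorelSpace E]
variable {ν : ℝ} {u : ℝ → E → E}

/-- **Every slice of a bounded ancient mild solution that vanishes at a.e. time is a.e.
constant.** If `u` is a bounded ancient mild solution (`0 < ν`, measurable slices) and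
`u(t, ·) = 0` a.e. for a.e. `t < 0`, then for *every* `t < 0` the slice `u(t, ·)` is a.e. equal
to a constant: the pairings `t ↦ ⟨u(t), φ⟩` with divergence-free test fields are continuous on
`(-∞, 0)` (`IsBoundedAncientMildSolution.continuousOn_integral_inner`) and vanish a.e., hence
everywhere (`Measure.eqOn_open_of_ae_eq`), and a bounded weakly divergence-free field
annihilating the divergence-free tests is a.e. constant (the `L^∞` annihilator lemma
`IsWeaklyDivFree.exists_ae_eq_const_of_norm_le_of_forall_integral_inner_eq_zero`). The constant
is the spatially constant ambiguity `b(t)` of KNSS 2009, §1. [folklore] -/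
theorem IsBoundedAncientMildSolution.exists_ae_eq_const_of_ae_restrict
    (hu : IsBoundedAncientMildSolution ν u) (hν : 0 < ν)
    (hmeas : ∀ t < 0, AEStronglyMeasurable (u t) volume)
    (hzero : ∀ᵐ t ∂(volume.restrict (Iio (0 : ℝ))), u t =ᵐ[volume] 0) :
    ∀ t < 0, ∃ b : E, u t =ᵐ[volume] fun _ => b := by
  intro t₀ ht₀
  obtain ⟨M, hM⟩ := hu.2
  refine IsWeaklyDivFree.exists_ae_eq_const_of_norm_le_of_forall_integral_inner_eq_zero
    (hmeas t₀ ht₀) (hM t₀ ht₀) (hu.1.1 t₀ ht₀) fun φ hφ hdiv => ?_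
  have hg : ContinuousOn (fun t => ∫ x, ⟪u t x, φ x⟫) (Iio 0) :=
    hu.continuousOn_integral_inner hν hmeas hφ hdiv
  have hg0 : (fun t => ∫ x, ⟪u t x, φ x⟫) =ᵐ[volume.restrict (Iio (0 : ℝ))] fun _ => (0 : ℝ) := by
    filter_upwards [hzero] with t ht
    refine integral_eq_zero_of_ae ?_
    filter_upwards [ht] with x hx
    simp [hx]
  exact Measure.eqOn_open_of_ae_eq hg0 isOpen_Iio hg continuousOn_const ht₀

end EverySlice

section R3

/-- Local notation for physical space `ℝ³ = EuclideanSpace ℝ (Fin 3)`. -/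
local notation "ℝ³" => EuclideanSpace ℝ (Fin 3)

variable {ν : ℝ} {u : ℝ → ℝ³ → ℝ³}

/-- **Every slice vanishes** if, in addition, each slice obeys the decay bound `r ‖u(t, x)‖ ≤ C`
almost everywhere (the constant of `exists_ae_eq_const_of_ae_restrict` is then zero,
`eq_zero_of_ae_eq_const_of_cylRadius_mul_norm_le`; KNSS 2009, end of the proof of Thm 5.3).
[cite: KochNadirashviliSereginSverak2009, proof of Thm 5.3, last paragraph (arXiv p. 10)] -/
theorem IsBoundedAncientMildSolution.ae_eq_zero_of_ae_restrict
    (hu : IsBoundedAncientMildSolution ν u) (hν : 0 < ν)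
    (hmeas : ∀ t < 0, AEStronglyMeasurable (u t) volume)
    (hbound : ∃ C : ℝ, ∀ t < 0, ∀ᵐ x ∂(volume : Measure ℝ³), cylRadius x * ‖u t x‖ ≤ C)
    (hzero : ∀ᵐ t ∂(volume.restrict (Iio (0 : ℝ))), u t =ᵐ[volume] 0) :
    ∀ t < 0, u t =ᵐ[volume] 0 := by
  intro t ht
  obtain ⟨b, hb⟩ := hu.exists_ae_eq_const_of_ae_restrict hν hmeas hzero t ht
  obtain ⟨C, hC⟩ := hbound
  have hb0 : b = 0 := eq_zero_of_ae_eq_const_of_cylRadius_mul_norm_le hb (hC t ht)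
  rw [hb0] at hb
  exact hb

/-- **The bridge, core form.** Under KNSS's Theorem 5.3 in the printed class
(`KNSS2009_liouville_bound_C_over_r`), a bounded ancient mild solution (`ν = 1`, duality form)
which is jointly a.e. strongly measurable on `(-∞, 0) × ℝ³`, has measurable slices, is
axisymmetric in the `L^∞` sense (for every angle, `w(t, R_θ x) = R_θ w(t, x)` a.e. in `x`, for
a.e. `t < 0`) and obeys `r ‖w(t, x)‖ ≤ C` a.e. on every slice `t < 0`, vanishes a.e. on *every*
slice: by `IsBoundedAncientMildSolution.isBoundedWeakNSSolutionOn` it is a bounded weak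
solution, Theorem 5.3 gives `w(t) = 0` a.e. for a.e. `t`, and `ae_eq_zero_of_ae_restrict`
upgrades this to every `t < 0`. [cite: KochNadirashviliSereginSverak2009, Thm 5.3 (arXiv p. 10)] -/
theorem KNSS2009_liouville_bound_C_over_r.ae_eq_zero_of_aestronglyMeasurable
    (h53 : KNSS2009_liouville_bound_C_over_r) {w : ℝ → ℝ³ → ℝ³}
    (hw : IsBoundedAncientMildSolution 1 w)
    (hjoint : AEStronglyMeasurable (uncurry w) ((volume : Measure (ℝ × ℝ³)).restrict (Iio 0 ×ˢ univ)))
    (hmeas : ∀ t < 0, AEStronglyMeasurable (w t) volume)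
    (haxi : ∀ θ : ℝ, ∀ᵐ t ∂(volume.restrict (Iio (0 : ℝ))),
      (fun x => w t (rotZ θ x)) =ᵐ[volume] fun x => rotZ θ (w t x))
    (hbound : ∃ C : ℝ, ∀ t < 0, ∀ᵐ x ∂(volume : Measure ℝ³), cylRadius x * ‖w t x‖ ≤ C) :
    ∀ t < 0, w t =ᵐ[volume] 0 := by
  have hweak : IsBoundedWeakNSSolutionOn (Iio 0) isOpen_Iio 1 w :=
    hw.isBoundedWeakNSSolutionOn one_pos hjoint hmeas
  have hbound' : ∃ C : ℝ, ∀ᵐ t ∂(volume.restrict (Iio (0 : ℝ))), ∀ᵐ x ∂(volume : Measure ℝ³),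
      cylRadius x * ‖w t x‖ ≤ C := by
    obtain ⟨C, hC⟩ := hbound
    exact ⟨C, (ae_restrict_iff' measurableSet_Iio).2 (Eventually.of_forall fun t ht => hC t ht)⟩
  exact hw.ae_eq_zero_of_ae_restrict one_pos hmeas hbound (h53 hweak haxi hbound')

/-- **The bridge for jointly measurable representatives.** Under KNSS's Theorem 5.3 in the
printed class, the duality-form statement `knss_bound_C_over_r` holds for every `u` which is,
in addition to its hypotheses, jointly a.e. strongly measurable on `(-∞, 0) × ℝ³` (pointwise
axisymmetry and decay imply their a.e. forms, `ae_rotZ_of_isAxisymmetric`). What separates this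
from `knss_bound_C_over_r` itself is only the existence of a jointly measurable modification of
an arbitrary family in the duality-form class (see `knss_bound_C_over_r_of_KNSS2009_of_modification`).
[cite: KochNadirashviliSereginSverak2009, Thm 5.3 (arXiv p. 10)] -/
theorem knss_bound_C_over_r_of_KNSS2009_of_aestronglyMeasurable
    (h53 : KNSS2009_liouville_bound_C_over_r) {u : ℝ → ℝ³ → ℝ³}
    (hu : IsBoundedAncientMildSolution 1 u)
    (hjoint : AEStronglyMeasurable (uncurry u) ((volume : Measure (ℝ × ℝ³)).restrict (Iio 0 ×ˢ univ)))
    (hmeas : ∀ t < 0, AEStronglyMeasurable (u t) volume)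
    (haxi : ∀ t < 0, IsAxisymmetric (u t))
    (hbound : ∃ C : ℝ, ∀ t < 0, ∀ x, cylRadius x * ‖u t x‖ ≤ C) :
    ∀ t < 0, u t =ᵐ[volume] 0 := by
  obtain ⟨C, hC⟩ := hbound
  exact h53.ae_eq_zero_of_aestronglyMeasurable hu hjoint hmeas (ae_rotZ_of_isAxisymmetric haxi)
    ⟨C, fun t ht => Eventually.of_forall (hC t ht)⟩

/-! ### Transfer along slice-wise a.e. modifications -/

/-- **The duality-form class is invariant under slice-wise a.e. modification** (with a pointwise
bound kept): if `w t = u t` a.e. for every `t < 0` and `w` is bounded on `(-∞, 0)`, then `w` is a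
bounded ancient mild solution whenever `u` is — every clause of the class is an integral over a
slice. [folklore] -/
theorem IsBoundedAncientMildSolution.congr_ae_slice
    {E : Type*} [NormedAddCommGroup E] [InnerProductSpace ℝ E] [FiniteDimensional ℝ E]
    [MeasurableSpace E] [BorelSpace E] {ν : ℝ} {u w : ℝ → E → E}
    (hu : IsBoundedAncientMildSolution ν u) (hwu : ∀ t < 0, w t =ᵐ[volume] u t)
    (hwb : IsBoundedOn (Iio 0) w) : IsBoundedAncientMildSolution ν w := by
  refine ⟨⟨fun t ht θ hθ => ?_, fun s t hst ht φ hφ hdiv => ?_⟩, hwb⟩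
  · rw [← hu.1.1 t ht θ hθ]
    refine integral_congr_ae ?_
    filter_upwards [hwu t ht] with x hx
    rw [hx]
  · have hs : s < 0 := hst.trans ht
    have key := hu.1.2 s t hst ht φ hφ hdiv
    have e1 : ∫ x, ⟪w t x, φ x⟫ = ∫ x, ⟪u t x, φ x⟫ := by
      refine integral_congr_ae ?_
      filter_upwards [hwu t ht] with x hx
      rw [hx]
    have e2 : ∫ x, ⟪w s x, heatTest ν φ (t - s) x⟫ = ∫ x, ⟪u s x, heatTest ν φ (t - s) x⟫ := by
      refine integral_congr_ae ?_
      filter_upwards [hwu s hs] with x hx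
      rw [hx]
    have e3 : (∫ τ in s..t, ∫ x, ⟪w τ x, convect (w τ) (heatTest ν φ (t - τ)) x⟫) =
        ∫ τ in s..t, ∫ x, ⟪u τ x, convect (u τ) (heatTest ν φ (t - τ)) x⟫ := by
      refine intervalIntegral.integral_congr fun τ hτ => ?_
      rw [uIcc_of_le hst.le] at hτ
      have hτ0 : τ < 0 := hτ.2.trans_lt ht
      refine integral_congr_ae ?_
      filter_upwards [hwu τ hτ0] with x hx
      simp only [convect_apply, hx]
    rw [e1, e2, e3]
    exact key

/-- **Truncation of a modification at the bound.** A jointly measurable slice-wise a.e.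
modification `w` of a field `u` bounded by `M` can be truncated to a jointly measurable
modification bounded by `M` everywhere. [folklore] -/
theorem exists_bounded_modification {u w : ℝ → ℝ³ → ℝ³} {M : ℝ} {μ : Measure (ℝ × ℝ³)}
    (hM : ∀ t < 0, ∀ x, ‖u t x‖ ≤ M)
    (hw : AEStronglyMeasurable (uncurry w) μ) (hwu : ∀ t < 0, w t =ᵐ[volume] u t) :
    ∃ w' : ℝ → ℝ³ → ℝ³, AEStronglyMeasurable (uncurry w') μ ∧ (∀ t < 0, w' t =ᵐ[volume] u t) ∧
      ∀ t x, ‖w' t x‖ ≤ max M 0 := by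
  refine ⟨fun t x => if ‖w t x‖ ≤ M then w t x else 0, ?_, fun t ht => ?_, fun t x => ?_⟩
  · obtain ⟨g, hg, hwg⟩ := hw
    refine ⟨fun p => if ‖g p‖ ≤ M then g p else 0, ?_, ?_⟩
    · exact StronglyMeasurable.ite (hg.norm.measurableSet_le stronglyMeasurable_const) hg
        stronglyMeasurable_const
    · filter_upwards [hwg] with p hp
      change (if ‖w p.1 p.2‖ ≤ M then w p.1 p.2 else 0) = if ‖g p‖ ≤ M then g p else 0
      have hp' : w p.1 p.2 = g p := hp
      rw [hp']
  · filter_upwards [hwu t ht] with x hx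
    simp only [hx, hM t ht x, if_true]
  · by_cases h : ‖w t x‖ ≤ M
    · simp only [h, if_true]
      exact h.trans (le_max_left _ _)
    · simp only [h, if_false, norm_zero]
      exact le_max_right _ _

/-- **The bridge, modulo jointly measurable modifications.** If every `u` in the hypotheses of
`knss_bound_C_over_r` admits a modification `w`, jointly a.e. strongly measurable on
`(-∞, 0) × ℝ³`, with `w t = u t` a.e. for every `t < 0`, then KNSS's Theorem 5.3 in the
printed class implies the duality-form fact `knss_bound_C_over_r`: truncate `w` at the bound
of `u` (`exists_bounded_modification`), transfer the class (`congr_ae_slice`), the symmetry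
(rotations preserve Lebesgue measure, `rotZLIE`) and the decay to `w` in their a.e. forms,
apply `KNSS2009_liouville_bound_C_over_r.ae_eq_zero_of_aestronglyMeasurable`, and transfer the
conclusion back. [cite: KochNadirashviliSereginSverak2009, Thm 5.3 (arXiv p. 10)] -/
theorem knss_bound_C_over_r_of_KNSS2009_of_modification
    (h53 : KNSS2009_liouville_bound_C_over_r)
    (hmod : ∀ u : ℝ → ℝ³ → ℝ³, IsBoundedAncientMildSolution 1 u →
      (∀ t < 0, AEStronglyMeasurable (u t) volume) → (∀ t < 0, IsAxisymmetric (u t)) →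
      (∃ C : ℝ, ∀ t < 0, ∀ x, cylRadius x * ‖u t x‖ ≤ C) →
      ∃ w : ℝ → ℝ³ → ℝ³,
        AEStronglyMeasurable (uncurry w) ((volume : Measure (ℝ × ℝ³)).restrict (Iio 0 ×ˢ univ)) ∧
        ∀ t < 0, w t =ᵐ[volume] u t) :
    knss_bound_C_over_r := by
  intro u hu hmeas haxi hbound
  obtain ⟨w₀, hw₀, hw₀u⟩ := hmod u hu hmeas haxi hbound
  obtain ⟨M, hM⟩ := hu.2
  obtain ⟨w, hw, hwu, hwM⟩ := exists_bounded_modification (fun t ht x => hM t ht x) hw₀ hw₀u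
  obtain ⟨C, hC⟩ := hbound
  -- `w` is in the class, with measurable slices, a.e. axisymmetric, a.e. decaying
  have hwcl : IsBoundedAncientMildSolution 1 w :=
    hu.congr_ae_slice hwu ⟨max M 0, fun t _ x => hwM t x⟩
  have hwmeas : ∀ t < 0, AEStronglyMeasurable (w t) volume := fun t ht =>
    (hmeas t ht).congr (hwu t ht).symm
  have hwaxi : ∀ θ : ℝ, ∀ᵐ t ∂(volume.restrict (Iio (0 : ℝ))),
      (fun x => w t (rotZ θ x)) =ᵐ[volume] fun x => rotZ θ (w t x) := by
    intro θ
    refine (ae_restrict_iff' measurableSet_Iio).2 (Eventually.of_forall fun t ht => ?_)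
    have hmp : MeasurePreserving (rotZ θ) (volume : Measure ℝ³) volume :=
      (rotZLIE θ).measurePreserving
    have h1 : (fun x => w t (rotZ θ x)) =ᵐ[volume] fun x => u t (rotZ θ x) :=
      hmp.quasiMeasurePreserving.ae_eq_comp (hwu t ht)
    filter_upwards [h1, hwu t ht] with x hx1 hx2
    rw [hx1, haxi t ht θ x, hx2]
  have hwbound : ∃ C : ℝ, ∀ t < 0, ∀ᵐ x ∂(volume : Measure ℝ³), cylRadius x * ‖w t x‖ ≤ C := by
    refine ⟨C, fun t ht => ?_⟩
    filter_upwards [hwu t ht] with x hx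
    rw [hx]
    exact hC t ht x
  intro t ht
  have hz := h53.ae_eq_zero_of_aestronglyMeasurable hwcl hw hwmeas hwaxi hwbound t ht
  exact (hwu t ht).symm.trans hz

end R3

end Literature.Analysis.FluidPDE
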